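import Summits.AtomisticToContinuum.Crystallization.Theorems.PhononSlackCertificatesNearFarGlueRPeriodicInsertion
import Summits.AtomisticToContinuum.Crystallization.Theorems.PhononSlackCertificatesNearFarGlueRSupercell
import Summits.AtomisticToContinuum.Crystallization.Theorems.ThreeConeCertificateExactCertificateSlacknessEnergy

/-!
# Crux `StrictCertificate` (stmt-AtomisticToContinuum-13167, route `BraggSlacknessRigidity`):
# necessary conditions on a witness, V — SINGLE-SITE STABILITY of the finite-range cone

Support file for the line `registered` (lead c4); nothing here closes the item.
Let `W : ℝ → ℝ` vanish on `[ρ_W, ∞)`, be `κ`-stable on finite configurations (`κ · N ≤ E_W(x)` for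
injective `x`), and let the periodic configuration `P` attain the constant, `e_W(P) ≤ κ` (so `= κ`,
weak duality `const_le_energyPerParticle_of_stable`).  Then **no single particle of `P` can be moved
with a gain of `W`-energy, all others fixed** (`singleSite_stability`): for every site `p₀ ∈ P` and
probe `w ∉ P`, `0 ≤ Σ'_{y ∈ P, y ≠ p₀} [W(dist w y) − W(dist p₀ y)]`.
PROOF (§2): re-present `P` on the sublattice `R·Λ` (`exists_supercell`: same points, same energy per
particle) with all non-zero periods longer than `ρ_W + dist w p₀`; erase the orbit of the motif
representative of `p₀`, insert the orbit of `w` (`exists_erase/insert_periodicConfiguration`); by the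
energy identity of single-orbit insertion for a FINITE-RANGE potential (§1, `finRange_insertion_identity`
= `stub_periodicInsertion` of `PhononSlack…PeriodicInsertion` with summability by finite support) the
two configurations differ per supercell by exactly twice the displayed sum (the self-interaction of the
moved orbit vanishes by the length of the periods), and weak duality for the displaced configuration
gives the sign.  Next file: for a witness `⟨P, ρ, c, g, U, f⟩` of `ExactCertificate` /
`StrictCertificate`, `g` is `(−c)`-stable with `e_g(P) = −c` (`Slackness.energyPerParticle_g_eq`), so
`ΔE_g(p₀ ↦ w) ≥ 0`, and with Einstein domination (`…StrictCertificateEinstein`) the `g`-terms drop out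
of the bound on `f 0 − f(dist w p₀)`.  All `[folklore]`.
-/
noncomputable section

namespace Summit.AtomisticToContinuum.Crystallization.Theorems.BraggSlacknessRigidityStrictCertificate

open scoped BigOperators Classical
open Literature.MathematicalPhysics.StatisticalMechanics
open Summit.AtomisticToContinuum.Crystallization.Theorems.ChargedEnergyGapNegative (E3)
open Summit.AtomisticToContinuum.Crystallization.Theorems.ChargedEnergyGapNegative.Blocks
  (siteSum sum_siteSum_eq)
open Summit.AtomisticToContinuum.Crystallization.Theorems.ThreeConeCertificateExactCertificate.Slackness
  (summable_of_finRange const_le_energyPerParticle_of_stable)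
open Summit.AtomisticToContinuum.Crystallization.Theorems.PhononSlackCertificatesNearFarGlueR
  (exists_insert_periodicConfiguration periodicInsertion_not_mem_points_iff
    periodicInsertion_exists_pos_le_dist exists_erase_periodicConfiguration
    periodicInsertion_tsum_points_eq exists_supercell)

/-! ## §1 Single-orbit insertion for a finite-range potential -/

section FiniteRange

variable {W : ℝ → ℝ} {ρW : ℝ}

/-- Finite-range fields of a periodic configuration are summable over every set of its points other
than the base point (finite support); in particular over all points when the base point is not one of
them. [folklore] -/
theorem finRange_summable_sub (Q : PeriodicConfiguration 3) (hW : ∀ r, ρW ≤ r → W r = 0) (x : E3)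
    {s : Set E3} (hs : s ⊆ {q : E3 | q ∈ Q.points ∧ q ≠ x}) :
    Summable ((fun q : E3 => W (dist x q)) ∘ (↑) : s → ℝ) := by
  have ht : Summable ((fun q : E3 => W (dist x q)) ∘ (↑) : ↥{q : E3 | q ∈ Q.points ∧ q ≠ x} → ℝ) :=
    summable_of_finRange Q hW x
  have key : ∀ {φ : E3 → ℝ} {t : Set E3}, s ⊆ t → Summable (φ ∘ (↑) : t → ℝ) →
      Summable (φ ∘ (↑) : s → ℝ) :=
    fun h hφ => hφ.comp_injective (Set.inclusion_injective h)
  exact key hs ht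

/-- See `finRange_summable_sub`. [folklore] -/
theorem finRange_summable_points (Q : PeriodicConfiguration 3) (hW : ∀ r, ρW ≤ r → W r = 0)
    {x : E3} (hx : x ∉ Q.points) :
    Summable ((fun q : E3 => W (dist x q)) ∘ (↑) : Q.points → ℝ) :=
  finRange_summable_sub Q hW x fun _ hq => ⟨hq, fun h => hx (h ▸ hq)⟩

/-- **Binding of the new point, orbit by orbit** (finite range): for `p ∉ P.points`,
`Σ_{x ∈ F} Σ'_{g ∈ G} W(|x − (p + g)|) = Σ'_{q ∈ P.points} W(|p − q|)`. [folklore] -/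
theorem finRange_cross (P : PeriodicConfiguration 3) (hW : ∀ r, ρW ≤ r → W r = 0) {p : E3}
    (hpS : p ∉ P.points) :
    ∑ x ∈ P.motif, ∑' g : P.lattice, W (dist x (p + g)) = ∑' q : P.points, W (dist p q) := by
  have hre : ∀ x ∈ P.motif, ∑' g : P.lattice, W (dist x (p + g)) =
      ∑' g : P.lattice, W (dist p (x + g)) := fun x _ => by
    rw [← (Equiv.neg P.lattice).tsum_eq]
    refine tsum_congr fun g => ?_
    simp only [Equiv.neg_apply, NegMemClass.coe_neg]
    rw [dist_comm p, dist_eq_norm, dist_eq_norm]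
    congr 2
    abel
  rw [Finset.sum_congr rfl hre,
    ← periodicInsertion_tsum_points_eq P (fun q => W (dist p q)) (finRange_summable_points P hW hpS)]

/-- **Row of an old point** (finite range): if `P'.points = P.points ∪ (p + G)` with `p ∉ P.points`,
then at `x ∈ P.points`, `siteSum P' W x = siteSum P W x + Σ'_{g ∈ G} W(|x − (p + g)|)`.
[folklore] -/
theorem finRange_row_old (P P' : PeriodicConfiguration 3) (hW : ∀ r, ρW ≤ r → W r = 0) {p : E3}
    (hpS : p ∉ P.points)
    (hpts : ∀ q : E3, q ∈ P'.points ↔ (q ∈ P.points ∨ ∃ g ∈ P.lattice, q = p + g))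
    {x : E3} (hx : x ∈ P.points) :
    siteSum P' W x = siteSum P W x + ∑' g : P.lattice, W (dist x (p + g)) := by
  have hpg : ∀ g ∈ P.lattice, p + g ∉ P.points := fun g hg h =>
    hpS (by simpa using P.add_mem_points h (P.lattice.neg_mem hg))
  set A : Set E3 := {q | q ∈ P.points ∧ q ≠ x} with hA
  set B : Set E3 := (fun g : E3 => p + g) '' (P.lattice : Set E3) with hB
  have hset : {q : E3 | q ∈ P'.points ∧ q ≠ x} = A ∪ B := by
    ext q
    simp only [hA, hB, Set.mem_setOf_eq, Set.mem_union, Set.mem_image, SetLike.mem_coe, hpts]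
    constructor
    · rintro ⟨hq | ⟨g, hg, rfl⟩, hne⟩
      · exact Or.inl ⟨hq, hne⟩
      · exact Or.inr ⟨g, hg, rfl⟩
    · rintro (⟨hq, hne⟩ | ⟨g, hg, rfl⟩)
      · exact ⟨Or.inl hq, hne⟩
      · exact ⟨Or.inr ⟨g, hg, rfl⟩, fun h => hpg g hg (h ▸ hx)⟩
  have hdisj : Disjoint A B :=
    Set.disjoint_left.2 (by rintro q ⟨hq, -⟩ ⟨g, hg, rfl⟩; exact hpg g hg hq)
  have hsA : Summable ((fun q : E3 => W (dist x q)) ∘ (↑) : A → ℝ) :=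
    finRange_summable_sub P' hW x (hset ▸ Set.subset_union_left)
  have hsB : Summable ((fun q : E3 => W (dist x q)) ∘ (↑) : B → ℝ) :=
    finRange_summable_sub P' hW x (hset ▸ Set.subset_union_right)
  have e1 : siteSum P' W x = ∑' q : ↥(A ∪ B), W (dist x q.1) :=
    (tsum_congr_set_coe (fun q => W (dist x q)) hset :)
  have e2 : ∑' q : ↥(A ∪ B), W (dist x q.1) = siteSum P W x + ∑' q : B, W (dist x q.1) :=
    (hsA.tsum_union_disjoint (f := fun q => W (dist x q)) hdisj hsB :)
  have e3 : ∑' q : B, W (dist x q.1) = ∑' g : P.lattice, W (dist x (p + g)) :=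
    (tsum_image (fun q => W (dist x q)) ((add_right_injective p).injOn (s := (P.lattice : Set E3))) :)
  rw [e1, e2, e3]

/-- **Row of the new point** (finite range): if `P'.points = P.points ∪ (p + G)` with `p ∉ P.points`,
then `siteSum P' W p = Σ'_{q ∈ P.points} W(|p − q|) + Σ'_{g ∈ G, g ≠ 0} W(|g|)`. [folklore] -/
theorem finRange_row_new (P P' : PeriodicConfiguration 3) (hW : ∀ r, ρW ≤ r → W r = 0) {p : E3}
    (hpS : p ∉ P.points)
    (hpts : ∀ q : E3, q ∈ P'.points ↔ (q ∈ P.points ∨ ∃ g ∈ P.lattice, q = p + g)) :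
    siteSum P' W p =
      (∑' q : P.points, W (dist p q)) + ∑' g : {g : E3 // g ∈ P.lattice ∧ g ≠ 0}, W ‖g.1‖ := by
  have hpg : ∀ g ∈ P.lattice, p + g ∉ P.points := fun g hg h =>
    hpS (by simpa using P.add_mem_points h (P.lattice.neg_mem hg))
  set L0 : Set E3 := {g | g ∈ P.lattice ∧ g ≠ 0} with hL0
  set B : Set E3 := (fun g : E3 => p + g) '' L0 with hB
  have hset : {q : E3 | q ∈ P'.points ∧ q ≠ p} = (P.points : Set E3) ∪ B := by
    ext q
    simp only [hB, hL0, Set.mem_setOf_eq, Set.mem_union, Set.mem_image, hpts]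
    constructor
    · rintro ⟨hq | ⟨g, hg, rfl⟩, hne⟩
      · exact Or.inl hq
      · exact Or.inr ⟨g, ⟨hg, fun h0 => hne (by rw [h0, add_zero])⟩, rfl⟩
    · rintro (hq | ⟨g, ⟨hg, hg0⟩, rfl⟩)
      · exact ⟨Or.inl hq, fun h => hpS (h ▸ hq)⟩
      · exact ⟨Or.inr ⟨g, hg, rfl⟩, fun h => hg0 (by simpa using h)⟩
  have hdisj : Disjoint (P.points : Set E3) B :=
    Set.disjoint_left.2 (by rintro q hq ⟨g, ⟨hg, -⟩, rfl⟩; exact hpg g hg hq)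
  have hsA : Summable ((fun q : E3 => W (dist p q)) ∘ (↑) : P.points → ℝ) :=
    finRange_summable_sub P' hW p (hset ▸ Set.subset_union_left)
  have hsB : Summable ((fun q : E3 => W (dist p q)) ∘ (↑) : B → ℝ) :=
    finRange_summable_sub P' hW p (hset ▸ Set.subset_union_right)
  have e1 : siteSum P' W p = ∑' q : ↥((P.points : Set E3) ∪ B), W (dist p q.1) :=
    (tsum_congr_set_coe (fun q => W (dist p q)) hset :)
  have e2 : ∑' q : ↥((P.points : Set E3) ∪ B), W (dist p q.1) =
      (∑' q : P.points, W (dist p q)) + ∑' q : B, W (dist p q.1) :=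
    (hsA.tsum_union_disjoint (f := fun q => W (dist p q)) hdisj hsB :)
  have e3 : ∑' q : B, W (dist p q.1) = ∑' g : L0, W (dist p (p + g)) :=
    (tsum_image (fun q => W (dist p q)) ((add_right_injective p).injOn (s := L0)) :)
  rw [e1, e2, e3]
  congr 1
  exact tsum_congr fun g => by rw [dist_self_add_right]

/-- **The energy identity of single-orbit insertion for a finite-range potential.**  Let `P, P'` be
periodic configurations of `ℝ³` and `p ∉ P.points` with `P'.motif = insert p P.motif` and
`P'.points = P.points ∪ (p + G)` (`G` the periods of `P`).  Then, with `n = #P.motif`,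
`W_p = Σ'_{q ∈ P.points} W(|p − q|)` and `T = Σ'_{g ∈ G, g ≠ 0} W(|g|)`,
`2 (n + 1) · e_W(P') = 2 n · e_W(P) + 2 · W_p + T`. [folklore] -/
theorem finRange_insertion_identity (P P' : PeriodicConfiguration 3) (hW : ∀ r, ρW ≤ r → W r = 0)
    {p : E3} (hpS : p ∉ P.points) (hmotif : P'.motif = insert p P.motif)
    (hpts : ∀ q : E3, q ∈ P'.points ↔ (q ∈ P.points ∨ ∃ g ∈ P.lattice, q = p + g)) :
    2 * ((P.motif.card : ℝ) + 1) * P'.energyPerParticle W =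
      2 * (P.motif.card : ℝ) * P.energyPerParticle W
        + 2 * (∑' q : P.points, W (dist p q))
        + ∑' g : {g : E3 // g ∈ P.lattice ∧ g ≠ 0}, W ‖g.1‖ := by
  have hpm : p ∉ P.motif := fun h => hpS (P.mem_points_of_mem_motif h)
  have hcard : (P'.motif.card : ℝ) = P.motif.card + 1 := by
    rw [hmotif, Finset.card_insert_of_notMem hpm, Nat.cast_add, Nat.cast_one]
  have h1 : 2 * ((P.motif.card : ℝ) + 1) * P'.energyPerParticle W =
      siteSum P' W p + ∑ x ∈ P.motif, siteSum P' W x := by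
    rw [← hcard, ← sum_siteSum_eq, hmotif, Finset.sum_insert hpm]
  rw [h1, finRange_row_new P P' hW hpS hpts,
    Finset.sum_congr rfl fun x hx => finRange_row_old P P' hW hpS hpts (P.mem_points_of_mem_motif hx),
    Finset.sum_add_distrib, sum_siteSum_eq, finRange_cross P hW hpS]
  ring

/-- With long periods the self-interaction of an inserted orbit vanishes:
`Σ'_{g ∈ G, g ≠ 0} W(|g|) = 0` if `ρ_W ≤ |g|` for every non-zero period. [folklore] -/
theorem finRange_selfTerm_eq_zero (P : PeriodicConfiguration 3) (hW : ∀ r, ρW ≤ r → W r = 0)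
    (hlong : ∀ g ∈ P.lattice, g ≠ 0 → ρW ≤ ‖g‖) :
    ∑' g : {g : E3 // g ∈ P.lattice ∧ g ≠ 0}, W ‖g.1‖ = 0 := by
  rw [tsum_congr fun g : {g : E3 // g ∈ P.lattice ∧ g ≠ 0} =>
    (hW _ (hlong g.1 g.2.1 g.2.2) : W ‖g.1‖ = 0)]
  exact tsum_zero

end FiniteRange


/-! ## §2 Single-site stability -/

section SingleSite

variable {W : ℝ → ℝ} {ρW κ : ℝ}

/-- **Core case** (site in the motif, `#motif ≥ 2`, every non-zero period longer than `ρ_W + dist w z`):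
`0 ≤ Σ'_{y ∈ Q, y ≠ z} [W(dist w y) − W(dist z y)]` — erase the orbit of `z`, insert the orbit of `w`,
compare the two insertion identities through weak duality. [folklore] -/
theorem singleSite_core (Q : PeriodicConfiguration 3) (hW : ∀ r, ρW ≤ r → W r = 0)
    (hst : ∀ (N : ℕ) (x : Fin N → E3), Function.Injective x → κ * N ≤ interactionEnergy W x)
    (he : Q.energyPerParticle W ≤ κ) {z w : E3} (hz : z ∈ Q.motif) (h2 : 2 ≤ Q.motif.card)
    (hw : w ∉ Q.points) (hlong : ∀ g ∈ Q.lattice, g ≠ 0 → ρW + dist w z ≤ ‖g‖) :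
    0 ≤ ∑' y : {y : E3 // y ∈ Q.points ∧ y ≠ z}, (W (dist w y.1) - W (dist z y.1)) := by
  obtain ⟨P₀, -, h0l, h0p, hQm, hQp, -⟩ := exists_erase_periodicConfiguration Q hz h2
  -- `z, w ∉ P₀.points`
  have hzS : z ∉ P₀.points := fun h =>
    ((h0p z).1 h).2 ⟨0, Q.lattice.zero_mem, (add_zero z).symm⟩
  have hwS : w ∉ P₀.points := fun h => hw ((h0p w).1 h).1
  -- long periods for `P₀` (same lattice): the self-interaction of an inserted orbit vanishes
  have hlong0 : ∀ g ∈ P₀.lattice, g ≠ 0 → ρW ≤ ‖g‖ := fun g hg hne =>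
    le_trans (le_add_of_nonneg_right dist_nonneg) (hlong g ((h0l g).1 hg) hne)
  have hT : ∑' g : {g : E3 // g ∈ P₀.lattice ∧ g ≠ 0}, W ‖g.1‖ = 0 :=
    finRange_selfTerm_eq_zero P₀ hW hlong0
  -- removal identity (`Q = P₀ +` orbit of `z`) and insertion identity (`Q' = P₀ +` orbit of `w`)
  have hrem := finRange_insertion_identity P₀ Q hW hzS hQm hQp
  obtain ⟨Q', hQ'm, -, hQ'p⟩ := exists_insert_periodicConfiguration P₀ w
    ((periodicInsertion_not_mem_points_iff P₀ w).1 hwS)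
  have hins := finRange_insertion_identity P₀ Q' hW hwS hQ'm hQ'p
  rw [hT] at hrem hins
  -- weak duality for `Q'`, attainment for `Q`
  have hQ' : κ ≤ Q'.energyPerParticle W := const_le_energyPerParticle_of_stable Q' hW hst
  have h3 : 2 * ((P₀.motif.card : ℝ) + 1) * Q.energyPerParticle W ≤
      2 * ((P₀.motif.card : ℝ) + 1) * Q'.energyPerParticle W :=
    mul_le_mul_of_nonneg_left (he.trans hQ')
      (by have h8 : (0 : ℝ) ≤ P₀.motif.card := Nat.cast_nonneg _; linarith)
  have key : (∑' q : P₀.points, W (dist z q)) ≤ ∑' q : P₀.points, W (dist w q) := by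
    linarith [hrem, hins, h3]
  -- the displacement family lives on `P₀.points`: it vanishes on the rest of the orbit of `z`
  set φ : E3 → ℝ := fun y => W (dist w y) - W (dist z y) with hφ
  set L0 : Set E3 := {g | g ∈ P₀.lattice ∧ g ≠ 0} with hL0
  set B : Set E3 := (fun g : E3 => z + g) '' L0 with hB
  have hzg : ∀ g ∈ P₀.lattice, z + g ∉ P₀.points := fun g hg h =>
    hzS (by simpa using P₀.add_mem_points h (P₀.lattice.neg_mem hg))
  have hset : {y : E3 | y ∈ Q.points ∧ y ≠ z} = (P₀.points : Set E3) ∪ B := by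
    ext q
    simp only [hB, hL0, Set.mem_setOf_eq, Set.mem_union, Set.mem_image, hQp]
    constructor
    · rintro ⟨hq | ⟨g, hg, rfl⟩, hne⟩
      · exact Or.inl hq
      · exact Or.inr ⟨g, ⟨hg, fun h0 => hne (by rw [h0, add_zero])⟩, rfl⟩
    · rintro (hq | ⟨g, ⟨hg, hg0⟩, rfl⟩)
      · exact ⟨Or.inl hq, fun h => hzS (h ▸ hq)⟩
      · exact ⟨Or.inr ⟨g, hg, rfl⟩, fun h => hg0 (by simpa using h)⟩
  have hdisj : Disjoint (P₀.points : Set E3) B :=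
    Set.disjoint_left.2 (by rintro q hq ⟨g, ⟨hg, -⟩, rfl⟩; exact hzg g hg hq)
  have hφB : ∀ y ∈ B, φ y = 0 := by
    rintro y ⟨g, ⟨hg, hg0⟩, rfl⟩
    have h1 : ρW + dist w z ≤ ‖g‖ := hlong g ((h0l g).1 hg) hg0
    have hz' : W (dist z (z + g)) = 0 :=
      hW _ (by rw [dist_self_add_right]; linarith [dist_nonneg (x := w) (y := z)])
    have hw' : W (dist w (z + g)) = 0 := hW _ (by
      have h2 := dist_triangle z w (z + g)
      rw [dist_self_add_right, dist_comm z w] at h2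
      linarith)
    show W (dist w (z + g)) - W (dist z (z + g)) = 0
    rw [hz', hw', sub_zero]
  have hsw : Summable ((fun q : E3 => W (dist w q)) ∘ (↑) : P₀.points → ℝ) :=
    finRange_summable_points P₀ hW hwS
  have hsz : Summable ((fun q : E3 => W (dist z q)) ∘ (↑) : P₀.points → ℝ) :=
    finRange_summable_points P₀ hW hzS
  have hsA : Summable (φ ∘ (↑) : P₀.points → ℝ) := hsw.sub hsz
  have hsB : Summable (φ ∘ (↑) : B → ℝ) := summable_zero.congr fun y => (hφB y.1 y.2).symm
  have e1 : ∑' y : {y : E3 // y ∈ Q.points ∧ y ≠ z}, φ y.1 = ∑' y : ↥((P₀.points : Set E3) ∪ B), φ y.1 :=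
    (tsum_congr_set_coe φ hset :)
  have e2 : ∑' y : ↥((P₀.points : Set E3) ∪ B), φ y.1 = (∑' y : P₀.points, φ y) + ∑' y : B, φ y.1 :=
    (hsA.tsum_union_disjoint (f := φ) hdisj hsB :)
  have e3 : ∑' y : B, φ y.1 = 0 := by
    rw [tsum_congr fun y : B => hφB y.1 y.2]
    exact tsum_zero
  have e4 : ∑' y : P₀.points, φ y =
      (∑' q : P₀.points, W (dist w q)) - ∑' q : P₀.points, W (dist z q) :=
    (hsw.tsum_sub hsz :)
  rw [e1, e2, e3, e4]
  linarith [key]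

/-- **Lattice invariance of displacement sums**: translating the site, the probe and the summation
variable by a period does not change `Σ'_{y ≠ b} [W₁(dist a y) − W₂(dist b y)]`. [folklore] -/
theorem tsum_cavity_translate (P : PeriodicConfiguration 3) (W₁ W₂ : ℝ → ℝ) {a b μ : E3}
    (hμ : μ ∈ P.lattice) :
    ∑' y : {y : E3 // y ∈ P.points ∧ y ≠ b + μ}, (W₁ (dist (a + μ) y.1) - W₂ (dist (b + μ) y.1)) =
      ∑' y : {y : E3 // y ∈ P.points ∧ y ≠ b}, (W₁ (dist a y.1) - W₂ (dist b y.1)) := by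
  let e : {y : E3 // y ∈ P.points ∧ y ≠ b} ≃ {y : E3 // y ∈ P.points ∧ y ≠ b + μ} :=
    { toFun := fun y => ⟨y.1 + μ, P.add_mem_points y.2.1 hμ, fun h => y.2.2 (add_right_cancel h)⟩
      invFun := fun y => ⟨y.1 - μ, by
          simpa [sub_eq_add_neg] using P.add_mem_points y.2.1 (P.lattice.neg_mem hμ),
        fun h => y.2.2 (eq_add_of_sub_eq h)⟩
      left_inv := fun y => by ext1; simp
      right_inv := fun y => by ext1; simp }
  rw [← e.tsum_eq]
  refine tsum_congr fun y => ?_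
  show W₁ (dist (a + μ) (y.1 + μ)) - W₂ (dist (b + μ) (y.1 + μ)) = _
  rw [dist_add_right, dist_add_right]

/-- **SINGLE-SITE STABILITY OF A FINITE-RANGE CONE.**  If `W = 0` on `[ρ_W, ∞)` is `κ`-stable on
finite configurations and the periodic `P` attains the constant (`e_W(P) ≤ κ`), then for every site
`p₀ ∈ P` and probe `w ∉ P`, `0 ≤ Σ'_{y ∈ P, y ≠ p₀} [W(dist w y) − W(dist p₀ y)]`: moving one particle
of a ground-state crystal, all others fixed, never gains energy. [folklore] -/
theorem singleSite_stability (P : PeriodicConfiguration 3) (hW : ∀ r, ρW ≤ r → W r = 0)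
    (hst : ∀ (N : ℕ) (x : Fin N → E3), Function.Injective x → κ * N ≤ interactionEnergy W x)
    (he : P.energyPerParticle W ≤ κ) {p₀ w : E3} (hp₀ : p₀ ∈ P.points) (hw : w ∉ P.points) :
    0 ≤ ∑' y : {y : E3 // y ∈ P.points ∧ y ≠ p₀}, (W (dist w y.1) - W (dist p₀ y.1)) := by
  -- (1) non-zero periods of `P` have norm `≥ ρ₁ > 0`
  obtain ⟨ρ₁, hρ₁, hsep⟩ := periodicInsertion_exists_pos_le_dist P hp₀
  have hper : ∀ g ∈ P.lattice, g ≠ 0 → ρ₁ ≤ ‖g‖ := by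
    intro g hg hne
    have h1 : p₀ + g ∈ P.points := P.add_mem_points hp₀ hg
    have h2 : p₀ + g ≠ p₀ := fun h => hne (by simpa using h)
    have h3 := hsep _ h1 h2
    rwa [dist_self_add_right] at h3
  -- (2) the supercell factor `R'`, with `ρ_W + dist w p₀ ≤ R' ρ₁`
  set L : ℝ := ρW + dist w p₀ with hL
  obtain ⟨R, hR⟩ : ∃ R : ℕ, L / ρ₁ ≤ R := exists_nat_ge _
  let R' : ℕ := R + 1
  haveI : NeZero R' := ⟨Nat.succ_ne_zero R⟩
  have hR'pos : (0 : ℝ) < R' := by exact_mod_cast Nat.succ_pos R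
  have hR' : L ≤ (R' : ℝ) * ρ₁ := by
    have h1 : L / ρ₁ ≤ (R' : ℝ) := hR.trans (by exact_mod_cast Nat.le_succ R)
    rwa [div_le_iff₀ hρ₁] at h1
  obtain ⟨Q, hpts, hE, hlat, -⟩ := exists_supercell P R'
  have hlongQ : ∀ g ∈ Q.lattice, g ≠ 0 → L ≤ ‖g‖ := by
    intro g hg hne
    obtain ⟨g₀, hg₀, rfl⟩ := (hlat g).1 hg
    have hg₀ne : g₀ ≠ 0 := by rintro rfl; exact hne (smul_zero _)
    rw [norm_smul, Real.norm_of_nonneg hR'pos.le]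
    have h4 := hper g₀ hg₀ hg₀ne
    nlinarith
  have hlatP : ∀ g ∈ Q.lattice, g ∈ P.lattice := by
    intro g hg
    obtain ⟨g₀, hg₀, rfl⟩ := (hlat g).1 hg
    rw [Nat.cast_smul_eq_nsmul ℝ]
    exact nsmul_mem hg₀ R'
  -- (3) the motif representative `z` of `p₀` in `Q`, and the shifted probe `w − μ`
  have hp₀Q : p₀ ∈ Q.points := by rw [hpts]; exact hp₀
  obtain ⟨z, hz, μ, hμ, hp₀eq⟩ := hp₀Q
  have hμP : μ ∈ P.lattice := hlatP μ hμ
  have hw' : w - μ ∉ Q.points := by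
    rw [hpts]
    intro h
    have h5 := P.add_mem_points h hμP
    rw [sub_add_cancel] at h5
    exact hw h5
  have hdist : dist (w - μ) z = dist w p₀ := by
    rw [hp₀eq, ← dist_add_right (w - μ) z μ, sub_add_cancel]
  -- (4) transfer `(p₀, w) ↔ (z, w − μ)`
  have htr := tsum_cavity_translate P W W (a := w - μ) (b := z) hμP
  rw [sub_add_cancel, ← hp₀eq] at htr
  rw [htr]
  by_cases h2 : 2 ≤ Q.motif.card
  · -- at least two orbits: the core case on the supercell
    have hcore := singleSite_core Q hW hst (by rw [hE]; exact he) hz h2 hw'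
      (fun g hg hne => by rw [hdist]; exact hlongQ g hg hne)
    rw [hpts] at hcore
    exact hcore
  · -- one orbit: every other point differs from the site by a long period, all terms vanish
    have h1 : Q.motif.card = 1 := by
      have h6 := Q.motif_nonempty.card_pos
      omega
    obtain ⟨z₀, hz₀⟩ := Finset.card_eq_one.1 h1
    have hzz : z = z₀ := by
      rw [hz₀] at hz
      exact Finset.mem_singleton.1 hz
    have hterm : ∀ y : {y : E3 // y ∈ P.points ∧ y ≠ z},
        W (dist (w - μ) y.1) - W (dist z y.1) = 0 := by
      intro y
      have hyQ : y.1 ∈ Q.points := by rw [hpts]; exact y.2.1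
      obtain ⟨x, hx, g₁, hg₁, hy⟩ := hyQ
      have hxz : x = z := by
        rw [hz₀] at hx
        rw [Finset.mem_singleton.1 hx, hzz]
      have hdiff : y.1 - z ∈ Q.lattice := by
        rw [hy, hxz, add_sub_cancel_left]
        exact hg₁
      have hne : y.1 - z ≠ 0 := sub_ne_zero.2 y.2.2
      have hlen : L ≤ ‖y.1 - z‖ := hlongQ _ hdiff hne
      have hd1 : L ≤ dist z y.1 := by rwa [dist_comm, dist_eq_norm]
      have hWz : W (dist z y.1) = 0 :=
        hW _ (by rw [hL] at hd1; linarith [dist_nonneg (x := w) (y := p₀)])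
      have hWw : W (dist (w - μ) y.1) = 0 := hW _ (by
        have h7 := dist_triangle z (w - μ) y.1
        rw [dist_comm z (w - μ), hdist, hL] at *
        linarith)
      rw [hWz, hWw, sub_zero]
    rw [tsum_congr hterm, tsum_zero]

end SingleSite

/-- **Registered sub-goal `singleSite_stability_registered`** (the statement of `singleSite_stability`
with all names spelled out): single-site stability of a finite-range cone at a periodic configuration
attaining its stability constant. [folklore] -/
theorem singleSite_stability_registered : ∀ (P : Literature.MathematicalPhysics.StatisticalMechanics.PeriodicConfiguration 3) (W : ℝ → ℝ) (ρW κ : ℝ), (∀ r : ℝ, ρW ≤ r → W r = 0) → (∀ (N : ℕ) (x : Fin N → EuclideanSpace ℝ (Fin 3)), Function.Injective x → κ * N ≤ Literature.MathematicalPhysics.StatisticalMechanics.interactionEnergy W x) → P.energyPerParticle W ≤ κ → ∀ p₀ ∈ P.points, ∀ w ∉ P.points, 0 ≤ ∑' y : {y : EuclideanSpace ℝ (Fin 3) // y ∈ P.points ∧ y ≠ p₀}, (W (dist w y.1) - W (dist p₀ y.1)) :=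
  fun P _W _ρW _κ hW hst he _p₀ hp₀ _w hw => singleSite_stability P hW hst he hp₀ hw

end Summit.AtomisticToContinuum.Crystallization.Theorems.BraggSlacknessRigidityStrictCertificate

end
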